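import Summits.BirchSwinnertonDyer.BirchSwinnertonDyer.Theorems.EdixhovenFibreFiveSevenStarredOptimalManinUnitFiveSevenAssemblyIntegralValues
import Summits.BirchSwinnertonDyer.BirchSwinnertonDyer.Theorems.EdixhovenFibreFiveSevenStarredOptimalManinUnitFiveSevenCarayolFree
import HarnessLib

/-!
# F″ programme, the H″ socket CARAYOL-FREE: H″ ⟹ H (pure bookkeeping, factored once) and F″ ⟸ H″ with NO
# «level = conductor» hypothesis
# (route `EdixhovenFibreFiveSeven`, crux K★ `StarredOptimalManinUnitFiveSeven`, stmt-BirchSwinnertonDyer-22226, line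
# `kato-lever`; `--supports` 22226, helper)

Cell `pub/bsd-wall`, seat `bsd-line-edix-p5` g3 (WIDTH-5). TOOL theorems only (no definition, no named fact, no
`sorry`; H″ is a DISPLAYED HYPOTHESIS); nothing is closed or booked; BSD is not proved by any of this.

WHY. Seat edix-p4 g3's `KatoAssemblySocket.kato_neron_five_le_of_integralSL2NeronValues` (p602985) proves
**F″ ⟸ hlev + H″**, H″ = the P1 text's SL₂(ℤ)-type Néron value law at Kato's member with the semi-local integrality
(INT) of the values attached (= P1 ∘ P4-coh ∘ receptacle), `hlev` = Carayol's `IsNewformOf.level_eq_conductorNorm`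
(cite-only; over the tree ⟸ modularity, also cite-only). The sibling file `…CarayolFree` (p603089) removed `hlev`
from the value-law socket (`KatoCarayolFree.kato_neron_five_le_of_memberValueLaw'`: the two level facts `p ∣ N`,
`a_ℓ = 0` at `ℓ² ∣ N` come from the Fourier coefficients, `IsNewformOf.dvd_level_iff_dvd_conductorNorm` +
`IsNewform0.cuspCoeff_eq_zero_of_sq_dvd`). THIS FILE factors edix-p4's instantiation ONCE as the implication
**H″ ⟹ H** (`memberValueLaw_of_integralSL2NeronValues`; proof = p602985's body verbatim: P4-core
`exists_not_dvd_isIntegral_charSum_of_forall_semilocal_mem` on (INT) + `Λ z = 1 ⊗ x`, the adapters p601597 for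
guards / parity / Kato factor, the Thm-13.6 clause for `p ∤ num q`) and composes it with the Carayol-free socket:
★ `kato_neron_five_le_of_integralSL2NeronValues'` — **F″ ⟸ H″, no hlev**. Hence the final assembly (edix-p4 g3's
recipe, STATUS 03:43:09Z) reads
`kato_neron_five_le_of_sl2NeronValues' (hT₂) (hP) (hDR) (hP1) : F″ := kato_neron_five_le_of_integralSL2NeronValues' (…)`
— its cone holds P1 (`Kato2004.exists_member_sl2ZetaElement_neron_values`, p603032 in review), (S5b-tower), Kato II
Prop. 1.2.3 and Fontaine's de Rham fact, and NEITHER Carayol's theorem NOR the modularity theorem.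

WHAT IS PROVED.
* `memberValueLaw_of_integralSL2NeronValues` — **H″ ⟹ H** (H = the hypothesis of
  `KatoAssemblySocket.kato_neron_five_le_of_memberValueLaw`, binder list verbatim).
* ★ `kato_neron_five_le_of_integralSL2NeronValues'` — **F″ ⟸ H″** (no hlev).

References: [Kato2004Asterisque] (8.1.3) p. 180, §8.3 p. 181, Thm. 9.7 p. 189, Thm. 6.6 (1) p. 163, Thm. 13.6
p. 227; [CasselsFrohlichANT1967] Ch. II §10 (10.2); [KimNakamura2020] Cor. 2.4; [AtkinLehner1970] Thm. 3;
[DiamondShurman2005] Prop. 5.8.5, (8.44); programme map `Cruxes/StarredOptimalManinUnitFiveSeven/Lines/kato-lever-F2-programme.md`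
§4/§8; `Cruxes/ManinFrameResidueProper/P4-ROADMAP-manin-p1-g8.md` §1–§3.
-/

set_option autoImplicit false
-- the Theorems namespace of a single-conjunct summit repeats the summit name by design (D-0017)
set_option linter.dupNamespace false

noncomputable section

open scoped MatrixGroups ModularForm Classical NumberField TensorProduct
open Complex CongruenceSubgroup WeierstrassCurve IsDedekindDomain NumberField
open Literature.NumberTheory.GaloisRepresentations
open Literature.NumberTheory.EllipticCurves Literature.NumberTheory.EllipticCurves.ModularForms
open Literature.NumberTheory.EllipticCurves.Kato2004 Literature.NumberTheory.EllipticCurves.Kato2004.EulerSystemValues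
open Summit.BirchSwinnertonDyer.BirchSwinnertonDyer.Theorems.SemiLocalDescent
open Summit.BirchSwinnertonDyer.BirchSwinnertonDyer.Theorems.KatoNeronIsogenyTransport
open Summit.BirchSwinnertonDyer.BirchSwinnertonDyer.Theorems.KatoAssemblySocket

namespace Summit.BirchSwinnertonDyer.BirchSwinnertonDyer.Theorems.KatoCarayolFree

set_option backward.isDefEq.respectTransparency false in
/-- **H″ ⟹ H: the P1-shaped Néron value law at Kato's member WITH semi-local integrality (H″, edix-p4 g3's
`kato_neron_five_le_of_integralSL2NeronValues` hypothesis, verbatim) yields the member value law with `p`-integral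
character sum (H, the hypothesis of `KatoAssemblySocket.kato_neron_five_le_of_memberValueLaw`, verbatim).** Pure
instantiation: Kato's member `W′` and the level data `(ι, Λ, Ψ)`; the guards of the unit choice converted to
`c ≡ d ≡ 1 [ZMOD N]`, `gcd(cd, 6pm) = 1` (adapters `intModEq_one_of_natModEq_one`, `int_gcd_mul_eq_one_of_coprime`);
the Manin-symbol coordinate `q := n ξ ±` at the parity of `χ` (Thm. 13.6 clause, `not_dvd_num_of_padicValRat_eq_zero`);
the value law read at `χ̄` (`μ = χ̄(c)`, `ν = χ(d)`, `katoFactor_inv_reading`, parity adapters); the `p`-integrality of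
`y := Σ_b χ̄(b) ι(σ_b x)` from (INT) and `Λ z = 1 ⊗ x` by P4-core
(`exists_not_dvd_isIntegral_charSum_of_forall_semilocal_mem`). No Carayol, no modularity (none was used here by
p602985 either; the level fact entered only through the socket).
[cite: Kato2004Asterisque, (8.1.3) (p. 180), Thm. 9.7 (p. 189), Thm. 6.6 (1) (p. 163), Thm. 13.6 (p. 227)]
[cite: CasselsFrohlichANT1967, Ch. II §10 Theorem (10.2)] [cite: KimNakamura2020, Cor. 2.4] -/
theorem memberValueLaw_of_integralSL2NeronValues
    (H : ∀ (W : WeierstrassCurve ℚ) [W.IsElliptic] (p : ℕ) [Fact p.Prime],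
      ∃ (W' : WeierstrassCurve ℚ) (_ : W'.IsElliptic) (_ : W'.IsGloballyMinimal), IsIsogenous W W' ∧
      ∀ [ContinuousSMul ℤ_[p] (W'.tateModule p)] [Module.Free ℤ_[p] (W'.tateModule p)]
        [Module.Finite ℤ_[p] (W'.tateModule p)],
      ∀ {N : ℕ} [NeZero N] (f : CuspForm (Gamma0 N) 2), IsNewformOf W f →
      ∃ n : SL(2, ℤ) → Bool → ℚ,
        (p ≠ 2 → ∀ b : Bool, ∃ ξ : SL(2, ℤ), n ξ b ≠ 0 ∧ padicValRat p (n ξ b) = 0) ∧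
        ∀ (m : ℕ) [NeZero m],
          ∃ (ι : CyclotomicField m ℚ →+* ℂ)
            (Λ : H1 (tateRep W' p) (rootsOfUnityFixer ℚ m) →ₗ[ℤ_[p]] ℚ_[p] ⊗[ℚ] CyclotomicField m ℚ)
            (Ψ : ℚ_[p] ⊗[ℚ] CyclotomicField m ℚ ≃ₐ[ℚ]
              (Π w : ((Rat.HeightOneSpectrum.primesEquiv (R := 𝓞 ℚ)).symm ⟨p, Fact.out⟩).Extension
                (𝓞 (CyclotomicField m ℚ)), w.1.adicCompletion (CyclotomicField m ℚ))),
            (∀ (s : ℚ_[p]) (x : CyclotomicField m ℚ)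
              (w : ((Rat.HeightOneSpectrum.primesEquiv (R := 𝓞 ℚ)).symm ⟨p, Fact.out⟩).Extension
                (𝓞 (CyclotomicField m ℚ))),
              Ψ (s ⊗ₜ[ℚ] x) w =
                algebraMap (CyclotomicField m ℚ) (w.1.adicCompletion (CyclotomicField m ℚ)) x *
                algebraMap (((Rat.HeightOneSpectrum.primesEquiv (R := 𝓞 ℚ)).symm ⟨p, Fact.out⟩).adicCompletion ℚ)
                  (w.1.adicCompletion (CyclotomicField m ℚ)) ((Padic.adicCompletionEquiv (𝓞 ℚ) ⟨p, Fact.out⟩) s)) ∧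
            (5 ≤ p → ¬ W'.HasGoodReductionAtPrime p → ¬ W'.HasMultiplicativeReductionAtPrime p →
              m.Coprime (p * N) →
              (7 < p ∨ (Nat.Coprime (orderOf (p : ZMod m)) (p - 1) ∧
                ∀ P : (W'.baseChange ℚ_[p]).toAffine.Point, p • P = 0 → P = 0)) →
              ∀ (y : H1 (tateRep W' p) (rootsOfUnityFixer ℚ m))
                (w : ((Rat.HeightOneSpectrum.primesEquiv (R := 𝓞 ℚ)).symm ⟨p, Fact.out⟩).Extension
                  (𝓞 (CyclotomicField m ℚ))),
                Ψ (Λ y) w ∈ w.1.adicCompletionIntegers (CyclotomicField m ℚ)) ∧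
            ∀ (c d : ℤ) (ξ : SL(2, ℤ)), c ≡ 1 [ZMOD (N : ℤ)] → d ≡ 1 [ZMOD (N : ℤ)] →
              Int.gcd (c * d) (6 * p * m) = 1 →
              ∃ (z : H1 (tateRep W' p) (rootsOfUnityFixer ℚ m)) (x : CyclotomicField m ℚ),
                Λ z = (1 : ℚ_[p]) ⊗ₜ[ℚ] x ∧
                ∀ (χ : DirichletCharacter ℂ m) (Lχ : ℂ → ℂ), IsDepletedTwistedL f m (p * N) χ Lχ →
                  (χ (-1) = 1 →
                    charSum m ι χ x =
                      (((c : ℂ) ^ 2 - (c : ℂ) * χ (c : ZMod m)) * ((d : ℂ) ^ 2 - (d : ℂ) * (χ (d : ZMod m))⁻¹)) *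
                        ((n ξ true : ℚ) : ℂ) * (Lχ 1 / (W'.realPeriodRat : ℂ))) ∧
                  (χ (-1) = -1 →
                    charSum m ι χ x =
                      (((c : ℂ) ^ 2 - (c : ℂ) * χ (c : ZMod m)) * ((d : ℂ) ^ 2 - (d : ℂ) * (χ (d : ZMod m))⁻¹)) *
                        ((n ξ false : ℚ) : ℂ) * (Lχ 1 / (Complex.I * (W'.imaginaryPeriodRat : ℂ))))) :
    ∀ (V : WeierstrassCurve ℚ) [V.IsElliptic] [V.IsGloballyMinimal] {N : ℕ} [NeZero N]
      (f : CuspForm (Gamma0 N) 2), IsNewformOf V f → ∀ (p : ℕ) [Fact p.Prime], 5 ≤ p →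
      ¬ V.HasGoodReductionAtPrime p → ¬ V.HasMultiplicativeReductionAtPrime p →
      V.HasIrreducibleModPGaloisRep p → ∀ (m : ℕ) [NeZero m], m.Coprime (p * N) →
      (7 < p ∨ (Nat.Coprime (orderOf (p : ZMod m)) (p - 1) ∧
        ∀ P : (V.baseChange ℚ_[p]).toAffine.Point, p • P = 0 → P = 0)) →
      ∀ (χ : DirichletCharacter ℂ m), χ.IsPrimitive → χ ≠ 1 → ¬ p ∣ orderOf χ →
      ∃ (W : WeierstrassCurve ℚ) (_ : W.IsElliptic) (_ : W.IsGloballyMinimal), IsIsogenous V W ∧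
        (IsNewformOf W f → ¬ W.HasGoodReductionAtPrime p → ¬ W.HasMultiplicativeReductionAtPrime p →
          W.HasIrreducibleModPGaloisRep p →
          (7 < p ∨ (Nat.Coprime (orderOf (p : ZMod m)) (p - 1) ∧
            ∀ P : (W.baseChange ℚ_[p]).toAffine.Point, p • P = 0 → P = 0)) →
        ∀ (L : ℂ → ℂ), EulerSystemValues.IsDepletedTwistedL f m (p * N) χ⁻¹ L →
        ∀ c d : ℕ,
        (1 < c ∧ c ≡ 1 [MOD N] ∧ c ≡ 1 [MOD p] ∧ (p : ℤ) ∣ (c : ℤ) - 1 ∧ c.Coprime (6 * (m * (p * N))) ∧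
          IsUnit (c : ZMod m) ∧ χ (c : ZMod m) ≠ 1) →
        (1 < d ∧ d ≡ 1 [MOD N] ∧ d ≡ 1 [MOD p] ∧ (p : ℤ) ∣ (d : ℤ) - 1 ∧ d.Coprime (6 * (m * (p * N))) ∧
          IsUnit (d : ZMod m) ∧ χ (d : ZMod m) ≠ 1) →
        ∃ (q : ℚ) (y μ ν : ℂ), ¬ (p : ℤ) ∣ q.num ∧ (∃ s : ℕ, ¬ p ∣ s ∧ IsIntegral ℤ ((s : ℂ) * y)) ∧
          (μ = χ (c : ZMod m) ∨ μ = χ⁻¹ (c : ZMod m)) ∧ (ν = χ (d : ZMod m) ∨ ν = χ⁻¹ (d : ZMod m)) ∧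
          (χ.Even → y = ((c : ℂ) ^ 2 - (c : ℂ) * μ) * ((d : ℂ) ^ 2 - (d : ℂ) * ν) * (q : ℂ) *
            (L 1 / (W.realPeriodRat : ℂ))) ∧
          (χ.Odd → y = ((c : ℂ) ^ 2 - (c : ℂ) * μ) * ((d : ℂ) ^ 2 - (d : ℂ) * ν) * (q : ℂ) *
            (L 1 / (Complex.I * (W.imaginaryPeriodRat : ℂ))))) := by
  intro V _ _ N _ f hf p _ hp5 hgood hmult hirr m _ hm htors χ hχ hχ1 hord
  obtain ⟨W', hW'E, hW'M, hiso, hW'⟩ := H V p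
  letI : ContinuousSMul ℤ_[p] (W'.tateModule p) := TateModule.continuousSMul_padicInt
  haveI : Module.Free ℤ_[p] (W'.tateModule p) := W'.module_free_tateModule_holds p
  haveI : Module.Finite ℤ_[p] (W'.tateModule p) := W'.module_finite_tateModule_holds p
  obtain ⟨n, hn, hlevel⟩ := hW' f hf
  obtain ⟨ι, Λ, Ψ, hΨ, hint, hval⟩ := hlevel m
  refine ⟨W', hW'E, hW'M, hiso, fun _ hgoodW hmultW _ htorsW L hL c d hc hd ↦ ?_⟩
  obtain ⟨-, hcN, -, -, hccop, -, -⟩ := hc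
  obtain ⟨-, hdN, -, -, hdcop, -, -⟩ := hd
  have hint' := hint hp5 hgoodW hmultW hm htorsW
  have hp2 : p ≠ 2 := by omega
  -- Kato's guards for `(c, d)` in the P1 text's `ℤ`-currency
  have hcZ : (c : ℤ) ≡ 1 [ZMOD (N : ℤ)] := intModEq_one_of_natModEq_one hcN
  have hdZ : (d : ℤ) ≡ 1 [ZMOD (N : ℤ)] := intModEq_one_of_natModEq_one hdN
  have hgcd : Int.gcd ((c : ℤ) * (d : ℤ)) (6 * (p : ℤ) * (m : ℤ)) = 1 := int_gcd_mul_eq_one_of_coprime hccop hdcop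
  -- the parity of `χ` decides the sign `b` at which the Manin-symbol coordinate is taken
  by_cases hev : χ.Even
  · obtain ⟨ξ, hnξ0, hnξv⟩ := hn hp2 true
    obtain ⟨z, x, hΛz, hlaw⟩ := hval (c : ℤ) (d : ℤ) ξ hcZ hdZ hgcd
    obtain ⟨hlawE, -⟩ := hlaw χ⁻¹ L hL
    have hE : χ⁻¹ (-1) = 1 := (inv_apply_neg_one_eq_one_iff χ).2 hev
    have hlawE' := hlawE hE
    refine ⟨n ξ true, charSum m ι χ⁻¹ x, χ⁻¹ (c : ZMod m), χ (d : ZMod m),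
      not_dvd_num_of_padicValRat_eq_zero hnξ0 hnξv,
      exists_not_dvd_isIntegral_charSum_of_forall_semilocal_mem m p Ψ hΨ x (Λ z) hΛz (hint' z) ι χ⁻¹,
      Or.inr rfl, Or.inl rfl, fun _ ↦ ?_, fun hod ↦ ?_⟩
    · rw [hlawE', katoFactor_inv_reading]
      push_cast
      ring
    · exfalso
      have h1 : χ (-1) = 1 := hev
      have h2 : χ (-1) = -1 := hod
      rw [h1] at h2
      norm_num at h2
  · obtain ⟨ξ, hnξ0, hnξv⟩ := hn hp2 false
    obtain ⟨z, x, hΛz, hlaw⟩ := hval (c : ℤ) (d : ℤ) ξ hcZ hdZ hgcd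
    obtain ⟨-, hlawO⟩ := hlaw χ⁻¹ L hL
    refine ⟨n ξ false, charSum m ι χ⁻¹ x, χ⁻¹ (c : ZMod m), χ (d : ZMod m),
      not_dvd_num_of_padicValRat_eq_zero hnξ0 hnξv,
      exists_not_dvd_isIntegral_charSum_of_forall_semilocal_mem m p Ψ hΨ x (Λ z) hΛz (hint' z) ι χ⁻¹,
      Or.inr rfl, Or.inl rfl, fun hev' ↦ absurd hev' hev, fun hod ↦ ?_⟩
    have hO : χ⁻¹ (-1) = -1 := (inv_apply_neg_one_eq_neg_one_iff χ).2 hod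
    rw [hlawO hO, katoFactor_inv_reading]
    push_cast
    ring

set_option backward.isDefEq.respectTransparency false in
/-- ★ **F″ ⟸ H″, CARAYOL-FREE** (`KatoAssemblySocket.kato_neron_five_le_of_integralSL2NeronValues` with its
hypothesis `hlev` REMOVED; H″ verbatim): the P1 text's SL₂(ℤ)-type Néron value law at Kato's member with the
semi-local integrality of the values attached implies Kato's Néron-twisted integrality F″
(`kato_neron_isIntegral_twistedSymbolSum_of_additive_five_le`). Proof: `memberValueLaw_of_integralSL2NeronValues`
then the Carayol-free socket `kato_neron_five_le_of_memberValueLaw'` (level facts from the Fourier coefficients: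
Atkin–Lehner Thm. 3, Diamond–Shurman Prop. 5.8.5/(8.44)). With P4-coh ⟹ (INT) and P1 ⟹ the rest of H″, the assembled
F″ has neither Carayol's theorem nor modularity in its cone.
[cite: Kato2004Asterisque, (8.1.3) (p. 180), §8.3 (p. 181), Thm. 9.7 (p. 189), Thm. 6.6 (1) (p. 163), Thm. 13.6 (p. 227)]
[cite: CasselsFrohlichANT1967, Ch. II §10 Theorem (10.2)] [cite: KimNakamura2020, Cor. 2.4] [cite: AtkinLehner1970, Thm. 3] -/
theorem kato_neron_five_le_of_integralSL2NeronValues'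
    (H : ∀ (W : WeierstrassCurve ℚ) [W.IsElliptic] (p : ℕ) [Fact p.Prime],
      ∃ (W' : WeierstrassCurve ℚ) (_ : W'.IsElliptic) (_ : W'.IsGloballyMinimal), IsIsogenous W W' ∧
      ∀ [ContinuousSMul ℤ_[p] (W'.tateModule p)] [Module.Free ℤ_[p] (W'.tateModule p)]
        [Module.Finite ℤ_[p] (W'.tateModule p)],
      ∀ {N : ℕ} [NeZero N] (f : CuspForm (Gamma0 N) 2), IsNewformOf W f →
      ∃ n : SL(2, ℤ) → Bool → ℚ,
        (p ≠ 2 → ∀ b : Bool, ∃ ξ : SL(2, ℤ), n ξ b ≠ 0 ∧ padicValRat p (n ξ b) = 0) ∧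
        ∀ (m : ℕ) [NeZero m],
          ∃ (ι : CyclotomicField m ℚ →+* ℂ)
            (Λ : H1 (tateRep W' p) (rootsOfUnityFixer ℚ m) →ₗ[ℤ_[p]] ℚ_[p] ⊗[ℚ] CyclotomicField m ℚ)
            (Ψ : ℚ_[p] ⊗[ℚ] CyclotomicField m ℚ ≃ₐ[ℚ]
              (Π w : ((Rat.HeightOneSpectrum.primesEquiv (R := 𝓞 ℚ)).symm ⟨p, Fact.out⟩).Extension
                (𝓞 (CyclotomicField m ℚ)), w.1.adicCompletion (CyclotomicField m ℚ))),
            (∀ (s : ℚ_[p]) (x : CyclotomicField m ℚ)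
              (w : ((Rat.HeightOneSpectrum.primesEquiv (R := 𝓞 ℚ)).symm ⟨p, Fact.out⟩).Extension
                (𝓞 (CyclotomicField m ℚ))),
              Ψ (s ⊗ₜ[ℚ] x) w =
                algebraMap (CyclotomicField m ℚ) (w.1.adicCompletion (CyclotomicField m ℚ)) x *
                algebraMap (((Rat.HeightOneSpectrum.primesEquiv (R := 𝓞 ℚ)).symm ⟨p, Fact.out⟩).adicCompletion ℚ)
                  (w.1.adicCompletion (CyclotomicField m ℚ)) ((Padic.adicCompletionEquiv (𝓞 ℚ) ⟨p, Fact.out⟩) s)) ∧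
            (5 ≤ p → ¬ W'.HasGoodReductionAtPrime p → ¬ W'.HasMultiplicativeReductionAtPrime p →
              m.Coprime (p * N) →
              (7 < p ∨ (Nat.Coprime (orderOf (p : ZMod m)) (p - 1) ∧
                ∀ P : (W'.baseChange ℚ_[p]).toAffine.Point, p • P = 0 → P = 0)) →
              ∀ (y : H1 (tateRep W' p) (rootsOfUnityFixer ℚ m))
                (w : ((Rat.HeightOneSpectrum.primesEquiv (R := 𝓞 ℚ)).symm ⟨p, Fact.out⟩).Extension
                  (𝓞 (CyclotomicField m ℚ))),
                Ψ (Λ y) w ∈ w.1.adicCompletionIntegers (CyclotomicField m ℚ)) ∧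
            ∀ (c d : ℤ) (ξ : SL(2, ℤ)), c ≡ 1 [ZMOD (N : ℤ)] → d ≡ 1 [ZMOD (N : ℤ)] →
              Int.gcd (c * d) (6 * p * m) = 1 →
              ∃ (z : H1 (tateRep W' p) (rootsOfUnityFixer ℚ m)) (x : CyclotomicField m ℚ),
                Λ z = (1 : ℚ_[p]) ⊗ₜ[ℚ] x ∧
                ∀ (χ : DirichletCharacter ℂ m) (Lχ : ℂ → ℂ), IsDepletedTwistedL f m (p * N) χ Lχ →
                  (χ (-1) = 1 →
                    charSum m ι χ x =
                      (((c : ℂ) ^ 2 - (c : ℂ) * χ (c : ZMod m)) * ((d : ℂ) ^ 2 - (d : ℂ) * (χ (d : ZMod m))⁻¹)) *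
                        ((n ξ true : ℚ) : ℂ) * (Lχ 1 / (W'.realPeriodRat : ℂ))) ∧
                  (χ (-1) = -1 →
                    charSum m ι χ x =
                      (((c : ℂ) ^ 2 - (c : ℂ) * χ (c : ZMod m)) * ((d : ℂ) ^ 2 - (d : ℂ) * (χ (d : ZMod m))⁻¹)) *
                        ((n ξ false : ℚ) : ℂ) * (Lχ 1 / (Complex.I * (W'.imaginaryPeriodRat : ℂ))))) :
    kato_neron_isIntegral_twistedSymbolSum_of_additive_five_le :=
  kato_neron_five_le_of_memberValueLaw' (memberValueLaw_of_integralSL2NeronValues H)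

end Summit.BirchSwinnertonDyer.BirchSwinnertonDyer.Theorems.KatoCarayolFree

end
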